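import Summits.ValiantsHypothesis.ValiantsHypothesis.Theorems.LacunarySymmetroidMatrixDescartesCensusColumnDivisorRolle

/-!
# `MatrixDescartes` census — W4: elbow 5 in the kernel — the two-row-RESISTANT pair `ZP(5..20)` × `(0,2,3,7,21,38)`

HONEST FRAMING.  Object-search cell `pub-symmetroid`, item `DoorA26 = PosRootLawAt 2 6 19` (stmt-ValiantsHypothesis-19979,
OPEN, typed, never asserted).  ROW file for the method `…CensusColumnDivisorRolle` (column-divisor quotient Rolle on
the three-column residual, `countP_posRoots_resid38_le_three`): the hull-edge form of the long edge `5..20` of chamber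
1706 on the support `(0,2,3,7,21,38)` — one of the two supports the two-column tetranomial rows
`…TwoRowElbowFiveRows20*` miss (115 core supports, 113 rows; seat notes TWOROW-E1G19 §4, ELBOW5-E1G23 §(S4)) — has at
most `13 < 15 = #terms − 1` positive roots COUNTED WITH MULTIPLICITY whenever four pure terms carry the cell's signs, so
no hypothetical twenty on that support degenerates through this edge.  Proof: the edge form is the 16-term sum of the
term table; ten Euler twists (`countP_posRoots_le_countP_twists`) kill every exponent except the six pure terms
`a₀c_jX^{d_j}`, `a₁c_jX^{2+d_j}`; the six integer multipliers (products over the killed exponents, RE-VERIFIED here by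
`norm_num`) are `M_{0j} = −1216383451920, −510984936000, −201803857920` and `M_{1j} = −544436640000, −142768351440,
−34828185600`, with ratios `ν_j = M_{0j}/M_{1j} = 29638973/13266000, 377300/105417, 19208/3315`; with `l = −a₀/a₁ > 0`
and `B_j = a₁c_j·M_{1j} > 0` the residual is literally the 6-nomial of `countP_posRoots_resid38_le_three`.  With this
row the elbow-5 table of chamber 1706 stands at 457 / 460 (edge, support) pairs in the kernel; the three pairs on
`(0,2,3,7,22,40)` remain cell-level (engine-2 RESIST518/519/520, R1648).  Mirror statement (edge `0..15` on chamber
954) by `d ↦ −d` bookkeeping, not typed.  Nothing here bounds `ζ_sym(2,6)`, decides `DoorA26`, or bears on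
`MatrixDescartes` (stmt-ValiantsHypothesis-18050) / `VP ≠ VNP`.

[folklore] instance of the column-divisor method; no single source.
-/

-- `Summit.ValiantsHypothesis.ValiantsHypothesis.…` repeats a component by the D-0017 layout
-- (single-conjunct summit), which the `dupNamespace` linter flags; the name is mandated.
set_option linter.dupNamespace false

namespace Summit.ValiantsHypothesis.ValiantsHypothesis.Theorems.LacunarySymmetroidMatrixDescartes.Census

open Polynomial Finset
open scoped BigOperators Polynomial

set_option maxRecDepth 8192 in
/-- **`ZP(5..20)` on the two-row-resistant support `(0,2,3,7,21,38)`: at most `13 < 15` positive roots with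
multiplicity** (rows `(a₀,a₁)` × all three columns `(c₃,c₄,c₅)`; ten Euler twists, then
`countP_posRoots_resid38_le_three`).  The hull-edge form of the long edge `5..20` of chamber 1706 on this support,
`(a₀ + a₁X² + a₂X³ + a₃X⁷ + a₄X²¹ + a₅X³⁸)(c₃X⁷ + c₄X²¹ + c₅X³⁸) − (b₂X³ + b₃X⁷ + b₄X²¹ + b₅X³⁸)²` (16 terms), cannot be
Descartes-sharp with multiplicity when the pure terms `a₀c₃X⁷`, `a₁c₃X⁹`, `a₁c₄X²³`, `a₁c₅X⁴⁰` carry the cell's signs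
(the signs of `a₀c₄X²¹`, `a₀c₅X³⁸` then follow).  This support is one of the two that the two-column tetranomial test
misses on this edge (`…TwoRowElbowFiveRows20*`); it was dead at cell level by engine-2 g25's hull certificate
RESIST520 (R1648). [folklore] -/
theorem countP_posRoots_zp_5_20_le_on_2_3_7_21_38 (a₀ a₁ a₂ a₃ a₄ a₅ c₃ c₄ c₅ b₂ b₃ b₄ b₅ : ℝ) (s₀₃ : 0 < a₀ * c₃)
    (s₁₃ : a₁ * c₃ < 0) (s₁₄ : a₁ * c₄ < 0) (s₁₅ : a₁ * c₅ < 0) :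
    (((C a₀ + C a₁ * X ^ 2 + C a₂ * X ^ 3 + C a₃ * X ^ 7 + C a₄ * X ^ 21 + C a₅ * X ^ 38)
          * (C c₃ * X ^ 7 + C c₄ * X ^ 21 + C c₅ * X ^ 38)
        - (C b₂ * X ^ 3 + C b₃ * X ^ 7 + C b₄ * X ^ 21 + C b₅ * X ^ 38) ^ 2 : ℝ[X]).roots.countP (fun x => 0 < x))
      ≤ 13 := by
  classical
  -- term table: the six kept pure terms first, then the ten killed exponents
  set e : ℕ → ℕ := fun t => match t with
    | 0 => 7 | 1 => 21 | 2 => 38 | 3 => 9 | 4 => 23 | 5 => 40 | 6 => 6 | 7 => 10 | 8 => 14 | 9 => 24 | 10 => 28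
    | 11 => 41 | 12 => 42 | 13 => 45 | 14 => 59 | 15 => 76 | _ => 0 with he
  set c : ℕ → ℝ := fun t => match t with
    | 0 => a₀ * c₃ | 1 => a₀ * c₄ | 2 => a₀ * c₅ | 3 => a₁ * c₃ | 4 => a₁ * c₄ | 5 => a₁ * c₅ | 6 => -(b₂ ^ 2)
    | 7 => a₂ * c₃ - (b₂ * b₃ + b₂ * b₃) | 8 => a₃ * c₃ - b₃ ^ 2 | 9 => a₂ * c₄ - (b₂ * b₄ + b₂ * b₄)
    | 10 => a₃ * c₄ + a₄ * c₃ - (b₃ * b₄ + b₃ * b₄) | 11 => a₂ * c₅ - (b₂ * b₅ + b₂ * b₅) | 12 => a₄ * c₄ - b₄ ^ 2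
    | 13 => a₃ * c₅ + a₅ * c₃ - (b₃ * b₅ + b₃ * b₅) | 14 => a₄ * c₅ + a₅ * c₄ - (b₄ * b₅ + b₄ * b₅)
    | 15 => a₅ * c₅ - b₅ ^ 2 | _ => 0 with hc
  have hF : ((C a₀ + C a₁ * X ^ 2 + C a₂ * X ^ 3 + C a₃ * X ^ 7 + C a₄ * X ^ 21 + C a₅ * X ^ 38)
          * (C c₃ * X ^ 7 + C c₄ * X ^ 21 + C c₅ * X ^ 38)
        - (C b₂ * X ^ 3 + C b₃ * X ^ 7 + C b₄ * X ^ 21 + C b₅ * X ^ 38) ^ 2 : ℝ[X])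
      = ∑ t ∈ range 16, C (c t) * X ^ (e t) := by
    simp only [Finset.sum_range_succ, Finset.sum_range_zero, zero_add, he, hc, map_mul, map_neg,
      map_pow, map_add, map_sub]
    ring
  rw [hF]
  clear hF
  have step := countP_posRoots_le_countP_twists 16 e c (Ico 6 16)
  have hcard : (Ico 6 16).card = 10 := by simp
  rw [hcard] at step
  obtain ⟨M, hM⟩ : ∃ M : ℕ → ℝ, ∀ t, M t = ∏ u ∈ Ico 6 16, ((e t : ℝ) - e u) := ⟨_, fun _ => rfl⟩
  have hres : (∑ t ∈ range 16, C (c t * ∏ u ∈ Ico 6 16, ((e t : ℝ) - e u)) * X ^ (e t) : ℝ[X])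
      = C (c 0 * M 0) * X ^ (e 0) + C (c 1 * M 1) * X ^ (e 1) + C (c 2 * M 2) * X ^ (e 2)
        + C (c 3 * M 3) * X ^ (e 3) + C (c 4 * M 4) * X ^ (e 4) + C (c 5 * M 5) * X ^ (e 5) := by
    rw [Finset.range_eq_Ico, ← Finset.sum_Ico_consecutive _ (show 0 ≤ 6 by norm_num) (show 6 ≤ 16 by norm_num)]
    have hz : (∑ t ∈ Ico 6 16, C (c t * ∏ u ∈ Ico 6 16, ((e t : ℝ) - e u)) * X ^ (e t) : ℝ[X]) = 0 := by
      refine Finset.sum_eq_zero fun t ht => ?_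
      rw [Finset.prod_eq_zero ht (sub_self _), mul_zero, map_zero, zero_mul]
    rw [hz, add_zero, Nat.Ico_zero_eq_range]
    simp only [Finset.sum_range_succ, Finset.sum_range_zero, zero_add, ← hM]
  rw [hres] at step
  clear hres
  -- the six integer multipliers
  have unroll : ∀ t, M t = ((e t : ℝ) - e 6) * ((e t : ℝ) - e 7) * ((e t : ℝ) - e 8) * ((e t : ℝ) - e 9) *
      ((e t : ℝ) - e 10) * ((e t : ℝ) - e 11) * ((e t : ℝ) - e 12) * ((e t : ℝ) - e 13) * ((e t : ℝ) - e 14) *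
      ((e t : ℝ) - e 15) := by
    intro t
    rw [hM, Finset.prod_Ico_eq_prod_range]
    simp only [show (16 : ℕ) - 6 = 10 by norm_num, Finset.prod_range_succ, Finset.prod_range_zero, one_mul,
      Nat.reduceAdd]
  have hM0 : M 0 = -1216383451920 := by rw [unroll]; norm_num [he]
  have hM1 : M 1 = -510984936000 := by rw [unroll]; norm_num [he]
  have hM2 : M 2 = -201803857920 := by rw [unroll]; norm_num [he]
  have hM3 : M 3 = -544436640000 := by rw [unroll]; norm_num [he]
  have hM4 : M 4 = -142768351440 := by rw [unroll]; norm_num [he]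
  have hM5 : M 5 = -34828185600 := by rw [unroll]; norm_num [he]
  have e0 : e 0 = 7 := rfl
  have e1 : e 1 = 21 := rfl
  have e2 : e 2 = 38 := rfl
  have e3 : e 3 = 9 := rfl
  have e4 : e 4 = 23 := rfl
  have e5 : e 5 = 40 := rfl
  have c0 : c 0 = a₀ * c₃ := rfl
  have c1 : c 1 = a₀ * c₄ := rfl
  have c2 : c 2 = a₀ * c₅ := rfl
  have c3 : c 3 = a₁ * c₃ := rfl
  have c4 : c 4 = a₁ * c₄ := rfl
  have c5 : c 5 = a₁ * c₅ := rfl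
  rw [e0, e1, e2, e3, e4, e5, c0, c1, c2, c3, c4, c5, hM0, hM1, hM2, hM3, hM4, hM5] at step
  -- normal form of the residual: `a₀ = −l·a₁`, `B_j = a₁c_j·M_{1j} > 0`
  have ha₁ : a₁ ≠ 0 := by rintro rfl; simp at s₁₃
  have hc₃ : c₃ ≠ 0 := by rintro rfl; simp at s₁₃
  set l : ℝ := -a₀ / a₁ with hl
  have hl0 : 0 < l := by
    have h1 : a₀ * a₁ * (c₃ * c₃) < 0 := by
      rw [show a₀ * a₁ * (c₃ * c₃) = (a₀ * c₃) * (a₁ * c₃) by ring]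
      exact mul_neg_of_pos_of_neg s₀₃ s₁₃
    have h2 : 0 < c₃ * c₃ := mul_self_pos.2 hc₃
    have h3 : a₀ * a₁ < 0 := by
      by_contra h
      exact absurd h1 (not_lt.mpr (mul_nonneg (not_lt.mp h) h2.le))
    have h4 : l = -(a₀ * a₁) / (a₁ * a₁) := by rw [hl]; field_simp
    rw [h4]
    exact div_pos (neg_pos.2 h3) (mul_self_pos.2 ha₁)
  have hB₃ : 0 < a₁ * c₃ * (-544436640000) := mul_pos_of_neg_of_neg s₁₃ (by norm_num)
  have hB₄ : 0 < a₁ * c₄ * (-142768351440) := mul_pos_of_neg_of_neg s₁₄ (by norm_num)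
  have hB₅ : 0 < a₁ * c₅ * (-34828185600) := mul_pos_of_neg_of_neg s₁₅ (by norm_num)
  have ha₀ : a₀ = -l * a₁ := by rw [hl]; field_simp
  have hid : (C (a₀ * c₃ * -1216383451920) * X ^ 7 + C (a₀ * c₄ * -510984936000) * X ^ 21
        + C (a₀ * c₅ * -201803857920) * X ^ 38 + C (a₁ * c₃ * -544436640000) * X ^ 9
        + C (a₁ * c₄ * -142768351440) * X ^ 23 + C (a₁ * c₅ * -34828185600) * X ^ 40 : ℝ[X])
      = C (a₁ * c₃ * (-544436640000)) * X ^ 7 * (X ^ 2 - C (l * (29638973 / 13266000)))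
        + C (a₁ * c₄ * (-142768351440)) * X ^ 21 * (X ^ 2 - C (l * (377300 / 105417)))
        + C (a₁ * c₅ * (-34828185600)) * X ^ 38 * (X ^ 2 - C (l * (19208 / 3315))) := by
    apply Polynomial.funext
    intro x
    simp only [eval_add, eval_sub, eval_mul, eval_C, eval_X, eval_pow, ha₀]
    ring
  rw [hid] at step
  have h3 := countP_posRoots_resid38_le_three _ _ _ l hB₃ hB₄ hB₅ hl0
  exact (step.trans (Nat.add_le_add_right h3 _)).trans (by norm_num)

end Summit.ValiantsHypothesis.ValiantsHypothesis.Theorems.LacunarySymmetroidMatrixDescartes.Census
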